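import Summits.BirchSwinnertonDyer.Rank1Residual.P2.CongruentNumberPairsAtTwoEvenFiveFamily
import HarnessLib
import HarnessLib.Audit.Tags

/-!
# Sub-lane «bsd-p2»: the candidate law C-P2-1 on the U⁺-SILENT EVEN-FIVE HALF-FAMILY
# `𝒮⁻ = {2·p·q : p ≡ 5 (mod 8), q ≡ 3 (mod 4) primes, (p/q) = −1}` — TYPED AS TWO CONJECTURE `Prop`S
# (STATEMENTS ONLY: two `@[conjecture]` defs + their kernel equivalence modulo Monsky 1990 Cor 5.15;
# nothing asserted, 0 Literature facts, 0 (K), nothing booked, no mark moved)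

HONEST FRAMING (sub-lane «bsd-p2», run/shared/lean/b2b/bsd-rank1-residual/p2/, verbatim in every
file): the target of record is the FULL Birch–Swinnerton-Dyer formula for EVERY analytic-rank `≤ 1`
`E/ℚ` at ALL primes INCLUDING `2`; the odd-prime class ledger is referee A's; the `2`-part is OPEN
(cells O1 = X5 ∖ CM and O12 = the CM corner) and under census by «bsd-p2». Census / instrument
output at `2` = EVIDENCE / conjecture items with held-out validation, NEVER a Literature fact;
certificates close PAIRS (one isogeny class, `p = 2`), never classes. A conjecture `Prop` is a
SENTENCE — not a kernel door, not a fact, not a route: the 36 168 members of `𝒮⁻` below `3·10⁶` stay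
OUTSIDE (K) until the mechanism below is PRINTED-PROVED or proved in Lean. This file asserts NO
arithmetic fact; every declaration is a `def … : Prop` tagged `@[conjecture]` or a bookkeeping
theorem between the two `Prop`s whose only arithmetic input is a NAMED PUBLISHED FACT taken as an
explicit binder (`h515`).

## The family and why it is silent (tree facts, nothing new)

For primes `p ≡ 5 (mod 8)`, `q ≡ 3 (mod 4)` the curve `E_{2pq} : y² = x³ − (2pq)²x` has root number
`−1` (`2pq ≡ 6 (mod 8)`), lies in Monsky's 1990 Cor 5.15 family (2′) (`IsCor515Family (2pq)`; the
displayed fact `Monsky1990.cor515_rank_eq_one_and_card_selmerGroup_two` = `h515`: rank `1`,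
`#Sel₂ = 8`, hence `Ш(E_{2pq})[2^∞] = 0`, `primaryComponent_sha_two_eq_bot_of_cor515`), has
`#E_{2pq}(ℚ)_tors = 4` and `∏_ℓ c_ℓ = 2⁶` (`torsionOrder_congruentNumberCurve`,
`P2.twoExponent_tamagawa_two_mul_prime_mul`). On the half `(p/q) = +1` Tian–Yuan–Zhang's printed
second genus sum `Σ₂′(2pq)` is ODD and the tree PROVES `ord_{s=1} L(E_{2pq}, s) = 1 ∧ BSD(E_{2pq}, 2)`
modulo {`tyz_genusPointData`, GZK, Rédei–Reichardt, `h515`}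
(`P2.forall_bsdp_two_congruentNumberCurve_two_mul_five_mul`, the 𝒮⁺ theorem). On the half
`(p/q) = −1` — THIS file's `𝒮⁻` — `Σ₂′(2pq)` is EVEN (`P2.odd_genusClassNumber_genusField_two_mul_five_mul_iff`
and §2 of that file): the genus criterion (TYZ 2017 Thm 1.2 = A310, LLT24 / LTYZ25) is SILENT, and
no printed theorem decides `ord_{s=1} L = 1` or the `2`-part there (lit-2 L2-44 (4): Tian 2014
Thm 1.3 excludes two odd primes `≡ 5, 3/7 (mod 8)`; Kriz 2020 PRE inadmissible; no rank-one
`2`-converse for `j = 1728` in print).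

## The candidate law C-P2-1 «U⁻ / Monsky index» (p2-lead, `p2/STRUCTURE-p2.md` v0.4 §2, VERBATIM)

«For every `N = 2pq` with `p ≡ 5 (mod 8)`, `q ≡ 3 (mod 4)` primes and `(q/p) = −1` (the family `𝒮⁻`;
36 168 members below `3·10⁶`, NONE in (K)): Monsky's mock-Heegner point `S_N ∈ E_N(ℚ)` EQUALS Tian's
`X₀(32)`-Heegner point `y_N` up to sign and `2`-torsion (LEMMA (I)); hence — together with what is
PRINTED on all of `𝒮 = 𝒮⁺ ∪ 𝒮⁻` (Monsky 1990 Thm 5.14 (13)/(15) pp. 65–66 «`S_N ∈ Λ_N ∖ (2Λ_N + T)`»,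
Lemma 3.3 (2) + Remark p. 53 «rank `≤ 1` … index necessarily odd», Remark (2) p. 67 «rank exactly
one»; tree: `Monsky1990.cor515_rank_eq_one_and_card_selmerGroup_two`,
`primaryComponent_sha_two_eq_bot_of_cor515` (`Ш[2^∞] = 0`), `selmerCorank_two_eq_one_of_cor515`;
the odd-index clause is PRINTED-not-TYPED) — (a) `ord_{s=1} L(E_N, s) = 1` exactly and (c)
`BSD₂(E_N)`, i.e. `v₂(Ш_an(E_N)) = 0`. CONJECTURAL CONTENT = (a) + (c), both delivered at once by the
ONE mechanism LEMMA (I) (+ explicit Gross–Zagier on `X₀(32)`, TYZ Thm 3.3).»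

STATUS OF THE MECHANISM. LEMMA (I) (`S_N = ± y_N` mod `E_N[2]`) = PRINTED-ASSERTED, not
PRINTED-PROVED (lit-2 L2-44 print hunt `p2/lit/L2-44-LEMMA-I-PRINT-HUNT-lit2.md` @4890ed0c18e173cc:
Tian, Camb. J. Math. 2 (2014) Remark 2.5 p. 128 «the CM points `z_t` above are essentially the same
as those Monsky studied» + Def 2.7 — a remark / attribution, never a proposition with proof and never
with the sign / torsion normalisation; Robatino 1996 thesis = acq-10261 pending) ⇒ inadmissible as
a door binder (p2-lead L2-45), admissible as this conjecture's MECHANISM; read ×2 on paper as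
FOLLOWING in five steps (idea-2 T15 dossier `p2/idea-2/ROUTES.md` v1.15a §2n, lit-2 GEN 21).
NOT TYPABLE TODAY: the named `Prop`s of STRUCTURE-p2 v0.3 §6 (`MonskyIndexOdd_SMinus` =
«`S_N ∉ 2Λ_N + T`», `monskyPoint_eq_heegnerPoint_SMinus` = LEMMA (I)) quantify over Monsky's
`S_N / Λ_N`, which are NOT tree objects (`lean search 'mockHeegner|monskyPoint'` = 0;
`Monsky1990/MockHeegnerCongruentNumbers.lean` carries Cor 5.15 as a named fact + `IsCor515Family`
only); a reviewed Literature DEFINITION of `S_N` (Monsky 1990 §3 Def 3.4 / §5) is a definition item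
for the lane's SWEEP (option (ε)), not typed here. What IS typable, and typed below, is the
OBSERVABLE CONTENT (a)+(c) in the tree's currency (§1) and its SHARPER `Ш_an`-unit form (§2).

## Pre-registered evidence (registered BEFORE the deciding run; scored by p2-lead; EVIDENCE only)

* PR-P2-1 P-T15b — `p2/census-3/spec/EXPECT-PT15B.json` @4133e5a954d1b0e7 (20:41Z) before kit
  j173362 (engine G, PARI 2.15.4); cells `30⁻, 70⁻, 174⁻ ∈ 𝒮⁻` + `78⁺, 110⁺, 406⁺`: P0 6/6 · P1 6/6
  (`|r_N − 1| = 0` to 36 digits, `r_N := ĥ(s_N)·8ϖ/(√N·L′(E_N,1))`) · P2 6/6 (`m_N = 1`,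
  `Ш_an/m_N² = 1`) · P3 ONE pair `(u, t) = (−1, (−1, 0))` at 29/29 — HIT 6/6 (LEAD-OKS C3-69; bench
  FOLD2-PT15B identical).
* PR-P2-3 P-T15c — registered `p2/STRUCTURE-p2.md` v0.1 (2026-08-22T21:32:25Z) +
  `EXPECT-PT15C.json` @8e59b7e30ee324be (22:36:04Z, = EXPECT-PT15B blocks VERBATIM, only cells +
  anchor; custody PASS C3-73) before the ONE id j175172 (22:39:38Z; 22 s); sixteen BLIND cells
  `𝒮⁻ ∋ 182, 230, 286, 318, 430, 470, 494, 606, 638, 670, 806, 830` + `𝒮⁺` controls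
  `190, 222, 310, 518` + anchor 30: CAL 5/5 · P0 16/16 · P1 16/16 · P2 16/16 · P3 145/145 · anchor
  ok — HIT 16/16 (LEAD-OKS C3-74, 2026-08-22T22:53Z; `p2/census-3/out/pt15c/PT15C-score.md`
  @85fd7b93a6b82079; blind second fold `p2/bench/fold2/out/FOLD2-PT15C.json` @5aa5575855e58ba2).
* PR-P2-4 P-T15d — registered `p2/STRUCTURE-p2.md` v0.4 @6e0ac3a3d235d2c2 §3 (2026-08-22T22:50:08Z;
  the twelve smallest `𝒮⁻` members above `10⁴`: `10142, 10222, 10246, 10254, 10262, 10398, 10534,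
  10630, 10822, 10870, 10918, 11030` + controls `10014, 10126, 10310, 10390` + anchor 30; charter
  WAKE-C3-74 @21463ecf56b1aaa2) + `EXPECT-PT15D.json` @0ef17a8d508dc96d / `.md` @1bddd3cb49bdccfc
  (23:09:23Z, census-3 GEN 46; = EXPECT-PT15B blocks VERBATIM re-keyed as EXPECT-PT15C was; custody
  PASS C3-75) before the ONE id j176216 (PARI 2.15.4, 1 c, 49 s; 2026-08-22T23:21:17Z); census-3
  GEN 46 result line (HOME INBOX 23:29Z; `p2/census-3/out/pt15d/PT15D-score.md` @acf32724f45f195d,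
  `PT15D-fold.json` @6a71a6639854efed): CAL 5/5 · P0 16/16 · P1 16/16 · P2 16/16 · P3 573/573 ·
  N/A 0 · anchor ok (bench BLIND `p2/bench/fold2/out/FOLD2-PT15D.json` @4ae1c06cbdf5b7f4, posted
  BEFORE the result line, value for value); SCORE WORD OF RECORD (p2-lead, LEAD-OKS C3-76;
  `p2/STRUCTURE-p2.md` v0.5 @21d6fa8647b267d9 §3): «P-T15d: P0 16/16 · P1 16/16 · P2 16/16 ·
  P3 573/573 · N/A 0 · anchor ok — HIT 16/16» exactly by the registered hit_rule_v0.4, with three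
  RIDERS carried and said plainly — (R1) the second engine G is independent on 19/21 cells: on
  `10254⁻` and control `10014` the Heegner-side point is engine P's alone (G's rational candidate
  EQUALS engine P's `s_N` exactly but is unaccepted by G's own precision-scaled tolerance), i.e.
  «HIT 14/14 with 2 N/A» under the strict FLAGGED-as-N/A reading, a HIT by the registered rule either
  way; (R2) on `10222⁻, 10254⁻, 11030⁻, 10310` the generator `g_N` IS the saturation (primes `≤ 60`)
  of `s_N` (the registered `ellrank` ladder found no point; FLAGGED as registered), so `m_N = 1`
  there is evidence-grade exactly as the registration's note says; (R3) the 16 principal-class P3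
  arguments do not discriminate between the two registered pairs (counted in `n`; the all-rows pair
  is unique). ERRATUM of record (p2-ref R-G19-50 rider; p2-lead T-138): the SCORER fold
  `code/pt15d/fold_pt15d.py` was amended ONCE post-submit (5f94322e → ab6dbeca, one line in the N/A
  branch) BEFORE any output of j176216 was read (`PREREG-PT15D-ADDENDUM-1.md` @660cfc9a30e7480a,
  `SHA256SUMS.pre-id-addendum1` @43d404eb946fa309); instrument, EXPECT file and score word
  unaffected (the word is fold-independent per p2-ref's R1-from-raw). COUNT countersigned from the
  raw of j176216 by b2b REFEREE 2 GEN 125 (R2-125.8) and referee A GEN 180 (R184.7) — EVIDENCE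
  words; nothing booked. This file was proposed ONLY after that word read HIT (p2-lead T-132 /
  T-134 / T-135 / WAKE-T-136 @935c63ae6075f7ff: three surviving registrations; STRUCTURE-p2 v0.5 §6
  FIRED).
OBSERVED, NOT PREDICTED (reported as such): `m_N = 1` and `Ш_an = 1` on 38/38 cells so far
(6 + 16 + 16 distinct `N`); `s_N = ε·g_N + T` exactly in rational arithmetic on 38/38 (`ε = −1` on
5 of P-T15d's 16). A HIT moves NOTHING: no (K), no mark, no
door, no fact, no tier word. FALSIFIERS (registered kill letters K(a)–K(e), STRUCTURE-p2 §2): one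
`N ∈ 𝒮⁻` with `r_N ≠ 1`, or with `v₂(Ш_an(E_N)) ≠ 0` — the latter refutes §1's `Prop` at that pair
VERBATIM (it is `BSD(E_N, 2)` false at a rank-one pair).

## What this file types

§1 `CongruentSilentEvenFiveBSDTwo` — C-P2-1 (a)+(c) in OBSERVABLE form, byte-parallel to the landed
𝒮⁺ theorem `P2.forall_bsdp_two_congruentNumberCurve_two_mul_five_mul` with `jacobiSym p q = -1`
and the analytic rank made explicit. §2 `CongruentSilentEvenFiveOrdTwo` — the SHARPER form: the
rank-one datum `L′(E_{2pq}, 1) = x·Ω·Reg` with `x ∈ ℚˣ` and `ord₂ x = 2` (i.e. `Ш_an = x·16/2⁶ = x/4`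
is a `2`-adic unit; P-T15b/c's P1 ∧ P2). §3 bookkeeping: modulo Monsky's displayed fact `h515`
ALONE the two `Prop`s are EQUIVALENT in the kernel, through the landed door D-CN-5
`P2.bsdp_two_congruentNumberCurve_iff_of_cor515` (`BSD(E_N, 2) ⟺ ord₂ x = ord₂ ∏c_ℓ − 4`, no GZK /
Kolyvagin / modularity binder) with `ord₂ 2⁶ − 4 = 2` and `#E(ℚ)_tors = 4` — a kernel implication
between conjecture `Prop`s, asserting neither. §4 bookkeeping: with the conjecture as a HYPOTHESIS
and the 𝒮⁺ theorem's four binders, `BSD(E_{2pq}, 2)` on the WHOLE even-five family (both symbols) —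
C-P2-1 is exactly the missing half. Unit `b2b-bsdres-p2-typer` GEN 10 (draft, p2-lead T-134
spec = STRUCTURE-p2 v0.4 §6 / WAKE-T-135 prep) and GEN 11 (submission, WAKE-T-136); NEW file;
coordinates: idea-2 T15 (derivation record), lit-2 L2-44/45 (print status), census-3 P-T15b/c/d
(numerics), bench FOLD2 (blind re-scores).

References: [Monsky1990MockHeegner] Thm 5.14 (13)/(15) (pp. 65–66), Cor 5.15 (2′) (p. 66), Lemma 3.3
(2) + Remark (p. 53), Remarks (2)–(3) (p. 67); [Tian2014] Remark 2.5 (p. 128), Def 2.7, Thm 1.3;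
[TianYuanZhang2017] Thm 1.2, Thm 3.3, §3; [Miller2011LMS] Def 1.1; HOME `p2/STRUCTURE-p2.md` v0.4
§2/§3/§6 and v0.5 @21d6fa8647b267d9 §3/§6; `p2/LEAD-OKS.md` T-134, T-136, C3-69, C3-74, C3-76.
-/

noncomputable section

open scoped Classical

open WeierstrassCurve Literature.NumberTheory.EllipticCurves
  Literature.NumberTheory.EllipticCurves.Rank1Residual
  Literature.NumberTheory.EllipticCurves.Rank1Residual.Typed
  Literature.NumberTheory.EllipticCurves.Monsky1990
  Literature.NumberTheory.EllipticCurves.TianYuanZhang2017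
  Literature.NumberTheory.QuadraticFields.RedeiReichardt

set_option autoImplicit false

namespace Summit.BirchSwinnertonDyer.Rank1Residual.P2.Conjectures

/-! ## §1 C-P2-1 (a)+(c), observable form (nothing asserted) -/

/-- **`CongruentSilentEvenFiveBSDTwo` — candidate law C-P2-1 (a)+(c) on the U⁺-silent even-five
half-family `𝒮⁻`, OBSERVABLE form:** for all primes `p ≡ 5 (mod 8)`, `q ≡ 3 (mod 4)` with
`(p/q) = −1`, the congruent-number curve `E_{2pq} : y² = x³ − (2pq)²x` has `ord_{s=1} L(E_{2pq}, s) = 1`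
EXACTLY and `BSD(E_{2pq}, 2)` holds (Miller's `BSDp`). Byte-parallel to the PROVED 𝒮⁺ half
`P2.forall_bsdp_two_congruentNumberCurve_two_mul_five_mul` (`jacobiSym p q = 1`, modulo
{`tyz_genusPointData`, GZK, RR, `h515`}); on `𝒮⁻` the genus sum `Σ₂′(2pq)` is even and no printed
theorem applies. Rank `1`, `Ш[2^∞] = 0` are PRINTED on all of `𝒮` (Monsky 1990 Cor 5.15 (2′));
the conjectural content is (a) the analytic rank and (c) the `2`-part, both predicted by the
mechanism LEMMA (I) `S_N = ± y_N mod E_N[2]` (PRINTED-ASSERTED, Tian 2014 Remark 2.5) + explicit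
Gross–Zagier on `X₀(32)`. Evidence: pre-registered PR-P2-1 (HIT 6/6), PR-P2-3 (HIT 16/16),
PR-P2-4 (HIT 16/16, riders R1–R3; see the module docstring) — EVIDENCE, 0 (K). A `Prop`; nothing
asserted.
OPEN CONJECTURE — [status: open].
[cite: Monsky1990MockHeegner, Thm. 5.14 (pp. 65–66), Cor. 5.15 (2′) (p. 66), Remarks (2)–(3) (p. 67)]
[cite: Tian2014, Remark 2.5 (p. 128)] [cite: Miller2011LMS, Def. 1.1 (arXiv:1010.2431 p. 3)] -/
@[conjecture] def CongruentSilentEvenFiveBSDTwo : Prop :=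
  ∀ p q : ℕ, p.Prime → q.Prime → p % 8 = 5 → q % 4 = 3 → jacobiSym p q = -1 →
    (congruentNumberCurve (2 * (p * q))).analyticRank = 1 ∧
      BSDp (congruentNumberCurve (2 * (p * q))) 2

/-! ## §2 C-P2-1, the sharper `Ш_an`-unit form (nothing asserted) -/

/-- **`CongruentSilentEvenFiveOrdTwo` — candidate law C-P2-1, SHARPER form (the `Ш_an`-unit form):**
for all primes `p ≡ 5 (mod 8)`, `q ≡ 3 (mod 4)` with `(p/q) = −1` there is `x ∈ ℚ`, `x ≠ 0`, with
`L′(E_{2pq}, 1) = x · Ω(E_{2pq}) · Reg(E_{2pq}(ℚ))` (read on the globally minimal model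
`congruentNumberCurve (2pq)`) and `ord₂ x = 2` — i.e. `#Ш_an(E_{2pq}) = x · #E(ℚ)_tors² / ∏_ℓ c_ℓ =
x · 16 / 2⁶ = x/4` is a `2`-adic unit. This is exactly what P-T15b / P-T15c measured (P1: `r_N = 1`,
so `L′ = ĥ(g_N)·8ϖ/√N` up to the printed constants; P2: `Ш_an/m_N²` an odd `2`-adic unit) and what
LEMMA (I) + Monsky's odd index + explicit Gross–Zagier on `X₀(32)` (TYZ Thm 3.3) would deliver.
Equivalent to §1 modulo Monsky 1990 Cor 5.15 alone (§3). A `Prop`; nothing asserted.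
OPEN CONJECTURE — [status: open].
[cite: Monsky1990MockHeegner, Thm. 5.14 (pp. 65–66), Remark (p. 53), Remark (2) (p. 67)]
[cite: TianYuanZhang2017, Thm. 3.3] [cite: Miller2011LMS, Def. 1.1 (arXiv:1010.2431 p. 3)] -/
@[conjecture] def CongruentSilentEvenFiveOrdTwo : Prop :=
  ∀ p q : ℕ, p.Prime → q.Prime → p % 8 = 5 → q % 4 = 3 → jacobiSym p q = -1 →
    ∃ x : ℚ, x ≠ 0 ∧
      deriv (congruentNumberCurve (2 * (p * q))).entireLFunction 1 =
        (x : ℂ) * ((congruentNumberCurve (2 * (p * q))).realPeriodRat : ℂ) *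
          ((congruentNumberCurve (2 * (p * q))).regulator : ℂ) ∧
      padicValRat 2 x = 2

/-! ## §3 Bookkeeping: the two forms are equivalent modulo Monsky 1990 Cor 5.15 (asserting neither) -/

/-- The 𝒮-membership facts used by both directions: for primes `p ≡ 5 (mod 8)`, `q ≡ 3 (mod 4)`,
`2pq` is in Monsky's Cor 5.15 family (2′) (both signs of `(p/q)`), hence square-free and non-zero,
and `p ≠ 2`, `q ≠ 2`, `p ≠ q`. [cite: Monsky1990MockHeegner, Cor. 5.15 (2) (p. 66)] -/
theorem isCor515Family_two_mul_five_mul {p q : ℕ} (hp : p.Prime) (hq : q.Prime) (hp5 : p % 8 = 5)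
    (hq4 : q % 4 = 3) : IsCor515Family (2 * (p * q)) ∧ p ≠ 2 ∧ q ≠ 2 ∧ p ≠ q := by
  have hq8 : q % 8 = 3 ∨ q % 8 = 7 := by omega
  exact ⟨Or.inr (Or.inr (Or.inr (Or.inl ⟨p, q, hp, hq, hp5, hq8, rfl⟩))), by omega, by omega,
    fun h => by omega⟩

/-- **Sharper ⟹ observable, modulo `h515`.** Given Monsky 1990 Cor 5.15 (`h515`) and the
`Ш_an`-unit form `CongruentSilentEvenFiveOrdTwo`: for every `(p, q)` of `𝒮⁻` the landed door
D-CN-5 `P2.bsdp_two_congruentNumberCurve_iff_of_cor515` (rank from Monsky, analytic rank from the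
root number and `x ≠ 0`, `Ш[2^∞]` from the descent count; NO GZK / Kolyvagin / modularity binder)
gives `ord_{s=1} L = 1` and `BSD(E_{2pq}, 2) ⟺ ord₂ x = ord₂ ∏c_ℓ − 4 = 6 − 4 = 2` ✓. A kernel
implication between conjecture `Prop`s; asserts neither.
[cite: Monsky1990MockHeegner, Cor. 5.15 (p. 66) and Remark (2) (p. 67)]
[cite: Miller2011LMS, Def. 1.1 (arXiv:1010.2431 p. 3)] -/
theorem congruentSilentEvenFiveBSDTwo_of_ordTwo
    (h515 : cor515_rank_eq_one_and_card_selmerGroup_two) (h : CongruentSilentEvenFiveOrdTwo) :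
    CongruentSilentEvenFiveBSDTwo := by
  intro p q hp hq hp5 hq4 hj
  obtain ⟨hN, hp2, hq2, hne⟩ := isCor515Family_two_mul_five_mul hp hq hp5 hq4
  haveI : Fact (Nat.Prime 2) := ⟨Nat.prime_two⟩
  obtain ⟨x, hx0, hx, hv⟩ := h p q hp hq hp5 hq4 hj
  obtain ⟨-, htam⟩ := twoExponent_tamagawa_two_mul_prime_mul hp hq hp2 hq2 hne
  obtain ⟨hr1, hiff⟩ := bsdp_two_congruentNumberCurve_iff_of_cor515 h515 hN
    (torsionOrder_congruentNumberCurve hN.squarefree) hx0 hx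
  refine ⟨hr1, hiff.mpr ?_⟩
  rw [hv, htam, padicValNat.prime_pow]
  norm_num

/-- **Observable ⟹ sharper, modulo `h515`.** Conversely, given `h515` and
`CongruentSilentEvenFiveBSDTwo`: `ord_{s=1} L = 1` makes `L′(E_{2pq}, 1)` the leading coefficient
and non-zero (`leadingLCoeff_eq_deriv_of_analyticRank_eq_one`); Miller's `BSD(E, 2)` supplies
`#Ш_an = q ∈ ℚ` with `ord₂ q = ord₂ #Ш[2^∞] = 0` (`Ш[2^∞] = 0` by Cor 5.15,
`primaryComponent_sha_two_eq_bot_of_cor515`); unfolding `#Ш_an = L′·#tors²/(Ω·∏c·Reg)` with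
`#tors = 4`, `∏c = 2⁶` gives `L′ = (4q)·Ω·Reg` with `ord₂(4q) = 2`. Bookkeeping; asserts neither.
[cite: Miller2011LMS, §1 and Def. 1.1 (arXiv:1010.2431 p. 3)]
[cite: Monsky1990MockHeegner, Cor. 5.15 (p. 66)] -/
theorem congruentSilentEvenFiveOrdTwo_of_bsdTwo
    (h515 : cor515_rank_eq_one_and_card_selmerGroup_two) (h : CongruentSilentEvenFiveBSDTwo) :
    CongruentSilentEvenFiveOrdTwo := by
  intro p q hp hq hp5 hq4 hj
  obtain ⟨hN, hp2, hq2, hne⟩ := isCor515Family_two_mul_five_mul hp hq hp5 hq4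
  haveI := isElliptic_congruentNumberCurve hN.ne_zero
  haveI : Fact (Nat.Prime 2) := ⟨Nat.prime_two⟩
  obtain ⟨hr1, hbsd⟩ := h p q hp hq hp5 hq4 hj
  obtain ⟨-, -, y, hy, hval⟩ := hbsd
  -- `Ш[2^∞] = 0`, so `ord₂ y = 0`
  have hbot := primaryComponent_sha_two_eq_bot_of_cor515 h515 hN
  have hcard : Nat.card (AddCommGroup.primaryComponent (congruentNumberCurve (2 * (p * q))).sha 2) = 1 := by
    rw [hbot]; exact AddSubgroup.card_bot
  rw [hcard, padicValNat_one_right, Nat.cast_zero] at hval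
  -- the leading coefficient is `L′(E,1) ≠ 0`
  obtain ⟨hlead, hder⟩ := leadingLCoeff_eq_deriv_of_analyticRank_eq_one hr1
  have hT := torsionOrder_congruentNumberCurve hN.squarefree
  obtain ⟨-, htam⟩ := twoExponent_tamagawa_two_mul_prime_mul hp hq hp2 hq2 hne
  have hΩ : ((congruentNumberCurve (2 * (p * q))).realPeriodRat : ℂ) ≠ 0 := by
    exact_mod_cast (congruentNumberCurve (2 * (p * q))).realPeriodRat_pos_holds.ne'
  have hR : ((congruentNumberCurve (2 * (p * q))).regulator : ℂ) ≠ 0 := by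
    exact_mod_cast (congruentNumberCurve (2 * (p * q))).regulator_pos'.ne'
  -- unfold `#Ш_an` and solve for `L′`
  have hsha := hy
  rw [shaAn_def, hlead, hT, htam] at hsha
  push_cast at hsha
  have hderiv : deriv (congruentNumberCurve (2 * (p * q))).entireLFunction 1 =
      ((y * 4 : ℚ) : ℂ) * ((congruentNumberCurve (2 * (p * q))).realPeriodRat : ℂ) *
        ((congruentNumberCurve (2 * (p * q))).regulator : ℂ) := by
    rw [div_eq_iff (mul_ne_zero (mul_ne_zero hΩ (by norm_num)) hR)] at hsha
    push_cast
    linear_combination (1 / 16 : ℂ) * hsha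
  have hy0 : y ≠ 0 := by
    rintro rfl
    apply hder
    rw [hderiv]; push_cast; ring
  refine ⟨y * 4, mul_ne_zero hy0 four_ne_zero, hderiv, ?_⟩
  rw [padicValRat.mul hy0 four_ne_zero, hval, show (4 : ℚ) = ((2 ^ 2 : ℕ) : ℚ) by norm_num,
    padicValRat.of_nat, padicValNat.prime_pow]
  norm_num

/-- **C-P2-1: the observable and the `Ш_an`-unit forms are EQUIVALENT modulo Monsky 1990 Cor 5.15
alone.** Neither side is asserted. [cite: Monsky1990MockHeegner, Cor. 5.15 (p. 66)]
[cite: Miller2011LMS, Def. 1.1 (arXiv:1010.2431 p. 3)] -/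
theorem congruentSilentEvenFiveBSDTwo_iff_ordTwo
    (h515 : cor515_rank_eq_one_and_card_selmerGroup_two) :
    CongruentSilentEvenFiveBSDTwo ↔ CongruentSilentEvenFiveOrdTwo :=
  ⟨congruentSilentEvenFiveOrdTwo_of_bsdTwo h515, congruentSilentEvenFiveBSDTwo_of_ordTwo h515⟩

/-! ## §4 What the conjecture buys (bookkeeping; the conjecture is a HYPOTHESIS here, not asserted) -/

/-- **C-P2-1 is exactly the missing half of the even-five two-prime family.** Granted the displayed
facts of the PROVED 𝒮⁺ half (`hTYZ`, `hGZK`, `hR`, `h515` — the binders of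
`P2.forall_bsdp_two_congruentNumberCurve_two_mul_five_mul`, nothing more) AND the conjecture
`CongruentSilentEvenFiveBSDTwo` as a HYPOTHESIS: `BSD(E_{2pq}, 2)` for ALL primes `p ≡ 5 (mod 8)`,
`q ≡ 3 (mod 4)` — the symbol `(p/q) ∈ {±1}` (`p ≠ q`) splits the family into the proved half and
`𝒮⁻`. Bookkeeping; the conclusion is CONDITIONAL on an OPEN conjecture and adds 0 n to (K).
[cite: TianYuanZhang2017, Thm. 1.2, Thm. 3.5 and §1 (1.1)]
[cite: Monsky1990MockHeegner, Cor. 5.15 (2′) (p. 66)] [cite: Miller2011LMS, Def. 1.1 (arXiv:1010.2431 p. 3)] -/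
theorem forall_bsdp_two_congruentNumberCurve_two_mul_five_mul_of_conjecture
    (hTYZ : tyz_genusPointData) (hGZK : rank_eq_analyticRank_of_analyticRank_le_one)
    (hR : redeiReichardt_fourTwoCard_classGroup) (h515 : cor515_rank_eq_one_and_card_selmerGroup_two)
    (h : CongruentSilentEvenFiveBSDTwo) :
    ∀ p q : ℕ, p.Prime → q.Prime → p % 8 = 5 → q % 4 = 3 →
      BSDp (congruentNumberCurve (2 * (p * q))) 2 := by
  intro p q hp hq hp5 hq4
  have hne : p ≠ q := fun h => by omega
  have hg : (p : ℤ).gcd q = 1 := by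
    rw [Int.gcd_natCast_natCast]; exact (Nat.coprime_primes hp hq).mpr hne
  rcases jacobiSym.eq_one_or_neg_one hg with hj | hj
  · exact forall_bsdp_two_congruentNumberCurve_two_mul_five_mul hTYZ hGZK hR h515 p q hp hq hp5 hq4 hj
  · exact (h p q hp hq hp5 hq4 hj).2

end Summit.BirchSwinnertonDyer.Rank1Residual.P2.Conjectures

end
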